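import Literature.Analysis.FluidPDE.ConstantinDirectionDissipationProofs
import Literature.Analysis.FluidPDE.SpaceTimeCalculus
import Literature.Analysis.FluidPDE.SereginZajaczkowski2007
import HarnessLib

/-!
# Fluid computer — RESIDENCE CEILING of the enstrophy clock (energy budget, `ν > 0`)

HONEST FRAMING (cell `pub-fluidc`, verbatim): *low prior, high value-of-information experiment on Tao's
machine paradigm; NOT a claim that NS blows up.* Theorem side of the cell; nothing here is evidence of blow-up.

The cell reads every forward leg through its enstrophy amplification `Φ = Z(T_opt)/Z₀` and, since RULING R35 F6,
through OCCUPATION numbers (amplitude × residence time). The ν-ladder of the break-point field (p2 deposit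
`atlas/rung-next/p2-nuladder/`, STATUS 2026-08-23 l.4170) found `ν · Φ ≈ 0.18` across a factor 3 in `ν`: the peak
dissipation rate `ν Z_pk` is nearly `ν`-independent. This file types the one a-priori constraint that governs that
product — the **residence ceiling of every gradient-enstrophy level** of a Leray–Hopf classical solution, i.e.
Chebyshev-in-time on the energy inequality `ν ∫₀ᵀ ∫ |∇u|² ≤ ½‖u(0)‖₂²`
(`IsLerayHopfOn.lintegral_frobeniusNormSq_fderiv_of_classical`, Constantin 1990 (2.21) / Leray 1934 (5.2)):

* `volume_level_mul_le_energy` — for every level `L`,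
  `ν · L · |{t ∈ (0,T) : ∫ |∇u(t)|²_F ≥ L}| ≤ ½‖u(0)‖₂²`;
* `volume_level_le_energy_div` — the same as a bound on the residence time,
  `|{t ∈ (0,T) : ∫ |∇u(t)|²_F ≥ L}| ≤ ½‖u(0)‖₂² / (ν L)` (`ν > 0`, `0 < L < ∞`);
* `volume_level_window_le_energy_div` — in particular inside every terminal window `(t₀, T)`.

Reading for the cell (dictionary, not a theorem about bands): with `Z = ½∫|ω|² = ½∫|∇u|²_F` (divergence-free,
decaying slices) the time a leg can spend at enstrophy `≥ θ·Z_pk` is at most `E₀ / (2 ν θ Z_pk)`; an occupation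
number built on the enstrophy clock is therefore CAPPED by the energy budget, whereas the level occupation of a
blow-up must stay above the Cheskidov–Dai floor infinitely often (`LevelOccupationFloor`, `OccupationRestartFloor`).
For the ν-ladder legs (256³, horizon `0.172`): `E₀ = 92.13`, `Z_pk = Φ·Z₀`, `Z₀ = 4000`, so the ceiling on the
half-peak dwell `|{Z ≥ Z_pk/2}| ≤ E₀/(ν Z_pk)` reads `0.131 / 0.126 / 0.124` at `ν = 0.01 / 0.005 / 0.00333` against
measured dwells `0.048 / 0.043 / 0.045` — consistent, tight to a factor `2.7–3.0`, and nearly `ν`-independent on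
both sides (`ν Z_pk = 705 / 730 / 742`; 90 % of `E₀` is dissipated by `2·T_opt` at all three `ν`).

0 sorry; no new definitions or named facts.

## References

* P. Constantin, Comm. Math. Phys. 129 (1990) 241–266, §2 eq. (2.21). [Constantin1990]
* J. Leray, Acta Math. 63 (1934) 193–248, (5.2). [Leray1934]
-/

noncomputable section

open MeasureTheory Set Function Filter Topology
open scoped ENNReal NNReal
open Literature.Analysis.FluidPDE

namespace Summit.NavierStokesRegularity.FluidComputer.EnstrophyResidenceCeiling

variable {ν T : ℝ} {u : ℝ → (EuclideanSpace ℝ (Fin 3)) → (EuclideanSpace ℝ (Fin 3))} {p : ℝ → (EuclideanSpace ℝ (Fin 3)) → ℝ}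

/-- Measurability of the dissipation density `(t, x) ↦ |∇u(t, x)|²_F` of a classical solution on `[0, T)`, extended
by `0` off the slab `(0, T) × (EuclideanSpace ℝ (Fin 3))` (continuity of `D(u t)(x)` on the slab, `IsSmoothSpaceTimeOn.continuousOn_fderiv_slice`, the
tree's `SereginZajaczkowski2007.continuous_frobeniusNormSq`, and `ContinuousOn.measurable_piecewise`). [folklore] -/
theorem measurable_piecewise_dissipationDensity (hns : IsClassicalNSSolutionOn (Ico 0 T) ν 0 u p) :
    Measurable ((Ioo 0 T ×ˢ (univ : Set (EuclideanSpace ℝ (Fin 3)))).piecewise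
      (fun z : ℝ × (EuclideanSpace ℝ (Fin 3)) => ENNReal.ofReal (frobeniusNormSq (fderiv ℝ (u z.1) z.2))) 0) := by
  classical
  have hcont : ContinuousOn (fun z : ℝ × (EuclideanSpace ℝ (Fin 3)) => fderiv ℝ (u z.1) z.2) (Ico 0 T ×ˢ univ) :=
    hns.smooth_velocity.continuousOn_fderiv_slice (uniqueDiffOn_Ico 0 T)
  have hcont' : ContinuousOn (fun z : ℝ × (EuclideanSpace ℝ (Fin 3)) => ENNReal.ofReal (frobeniusNormSq (fderiv ℝ (u z.1) z.2)))
      (Ioo 0 T ×ˢ univ) :=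
    (ENNReal.continuous_ofReal.comp_continuousOn (SereginZajaczkowski2007.continuous_frobeniusNormSq.comp_continuousOn hcont)).mono
      (prod_mono Ioo_subset_Ico_self le_rfl)
  exact hcont'.measurable_piecewise continuousOn_const (measurableSet_Ioo.prod MeasurableSet.univ)

/-- **Residence ceiling of every gradient-enstrophy level (energy budget).** Let `(u, p)` be a classical solution of
the unforced Navier–Stokes system on `(EuclideanSpace ℝ (Fin 3)) × [0, T)`, `T > 0`, `ν ≥ 0`, which is Leray–Hopf from `u 0`. Then for every
level `L`: `ν · L · |{t ∈ (0, T) : L ≤ ∫ |∇u(t)|²_F}| ≤ ½‖u(0)‖₂²` — Chebyshev in time applied to the energy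
inequality `ν ∫₀ᵀ ∫ |∇u|²_F ≤ ½‖u(0)‖₂²` (Constantin 1990 (2.21); Leray 1934 (5.2)). [cite: Constantin1990, §2 eq. (2.21)] -/
theorem volume_level_mul_le_energy (hns : IsClassicalNSSolutionOn (Ico 0 T) ν 0 u p)
    (hlh : IsLerayHopfOn T ν 0 (u 0) u) (hT : 0 < T) (hν : 0 ≤ ν) (L : ℝ≥0∞) :
    ENNReal.ofReal ν * (L * volume {t ∈ Ioo 0 T |
        L ≤ ∫⁻ x, ENNReal.ofReal (frobeniusNormSq (fderiv ℝ (u t) x))}) ≤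
      ENNReal.ofReal (VectorCalculus.kineticEnergy (u 0)) := by
  classical
  set F : ℝ × (EuclideanSpace ℝ (Fin 3)) → ℝ≥0∞ := fun z => ENNReal.ofReal (frobeniusNormSq (fderiv ℝ (u z.1) z.2)) with hF
  set g : ℝ × (EuclideanSpace ℝ (Fin 3)) → ℝ≥0∞ := (Ioo 0 T ×ˢ (univ : Set (EuclideanSpace ℝ (Fin 3)))).piecewise F 0 with hg
  have hgm : Measurable g := measurable_piecewise_dissipationDensity hns
  set Z : ℝ → ℝ≥0∞ := fun t => ∫⁻ x, g (t, x) with hZ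
  have hZm : Measurable Z := hgm.lintegral_prod_right'
  have hZeq : ∀ t ∈ Ioo 0 T, Z t = ∫⁻ x, F (t, x) := by
    intro t ht
    refine lintegral_congr fun x => ?_
    rw [hg, piecewise_eq_of_mem _ _ _ (mk_mem_prod ht (mem_univ x))]
  have hset : volume {t ∈ Ioo 0 T | L ≤ ∫⁻ x, ENNReal.ofReal (frobeniusNormSq (fderiv ℝ (u t) x))} =
      volume.restrict (Ioo 0 T) {t | L ≤ Z t} := by
    rw [Measure.restrict_apply' measurableSet_Ioo]
    congr 1
    ext t
    simp only [mem_setOf_eq, mem_inter_iff]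
    constructor
    · rintro ⟨ht, hL⟩
      exact ⟨by rw [hZeq t ht]; exact hL, ht⟩
    · rintro ⟨hL, ht⟩
      exact ⟨ht, by rw [hZeq t ht] at hL; exact hL⟩
  have hmarkov : L * volume.restrict (Ioo 0 T) {t | L ≤ Z t} ≤ ∫⁻ t in Ioo 0 T, Z t :=
    mul_meas_ge_le_lintegral₀ hZm.aemeasurable L
  have hint : ∫⁻ t in Ioo 0 T, Z t = ∫⁻ t in Ioo 0 T, ∫⁻ x, F (t, x) :=
    setLIntegral_congr_fun measurableSet_Ioo hZeq
  obtain ⟨hfin, hE⟩ := hlh.lintegral_frobeniusNormSq_fderiv_of_classical hns hT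
  calc ENNReal.ofReal ν * (L * volume {t ∈ Ioo 0 T |
          L ≤ ∫⁻ x, ENNReal.ofReal (frobeniusNormSq (fderiv ℝ (u t) x))})
        = ENNReal.ofReal ν * (L * volume.restrict (Ioo 0 T) {t | L ≤ Z t}) := by rw [hset]
    _ ≤ ENNReal.ofReal ν * ∫⁻ t in Ioo 0 T, Z t := by gcongr
    _ = ENNReal.ofReal ν * ∫⁻ t in Ioo 0 T, ∫⁻ x, F (t, x) := by rw [hint]
    _ = ENNReal.ofReal (ν * (∫⁻ t in Ioo 0 T, ∫⁻ x, F (t, x)).toReal) := by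
        rw [ENNReal.ofReal_mul hν, ENNReal.ofReal_toReal hfin]
    _ ≤ ENNReal.ofReal (VectorCalculus.kineticEnergy (u 0)) := ENNReal.ofReal_le_ofReal hE

/-- **Residence-time form.** Under the same hypotheses with `ν > 0` and a level `0 < L < ∞`: the time spent at
gradient enstrophy `≥ L` obeys `|{t ∈ (0, T) : L ≤ ∫ |∇u(t)|²_F}| ≤ ½‖u(0)‖₂² / (ν L)`. [cite: Constantin1990, §2 eq. (2.21)] -/
theorem volume_level_le_energy_div (hns : IsClassicalNSSolutionOn (Ico 0 T) ν 0 u p)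
    (hlh : IsLerayHopfOn T ν 0 (u 0) u) (hT : 0 < T) (hν : 0 < ν) {L : ℝ≥0∞} (hL0 : L ≠ 0) (hLtop : L ≠ ∞) :
    volume {t ∈ Ioo 0 T | L ≤ ∫⁻ x, ENNReal.ofReal (frobeniusNormSq (fderiv ℝ (u t) x))} ≤
      ENNReal.ofReal (VectorCalculus.kineticEnergy (u 0)) / (ENNReal.ofReal ν * L) := by
  have h := volume_level_mul_le_energy hns hlh hT hν.le L
  have hν0 : ENNReal.ofReal ν ≠ 0 := by rwa [Ne, ENNReal.ofReal_eq_zero, not_le]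
  rw [ENNReal.le_div_iff_mul_le (Or.inl (mul_ne_zero hν0 hL0))
    (Or.inl (ENNReal.mul_ne_top ENNReal.ofReal_ne_top hLtop))]
  calc volume {t ∈ Ioo 0 T | L ≤ ∫⁻ x, ENNReal.ofReal (frobeniusNormSq (fderiv ℝ (u t) x))} *
          (ENNReal.ofReal ν * L)
        = ENNReal.ofReal ν * (L * volume {t ∈ Ioo 0 T |
            L ≤ ∫⁻ x, ENNReal.ofReal (frobeniusNormSq (fderiv ℝ (u t) x))}) := by ring
    _ ≤ ENNReal.ofReal (VectorCalculus.kineticEnergy (u 0)) := h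

/-- **Inside every terminal window.** For every `t₀ ∈ [0, T)` the residence of a gradient-enstrophy level inside
`(t₀, T)` obeys the same ceiling `½‖u(0)‖₂² / (ν L)` (monotonicity of the residence set; the energy budget does not
refill). In the cell's words: an occupation number built on the enstrophy clock is capped by the energy budget in
every window, however late. [cite: Constantin1990, §2 eq. (2.21)] -/
theorem volume_level_window_le_energy_div (hns : IsClassicalNSSolutionOn (Ico 0 T) ν 0 u p)
    (hlh : IsLerayHopfOn T ν 0 (u 0) u) (hT : 0 < T) (hν : 0 < ν) {L : ℝ≥0∞} (hL0 : L ≠ 0) (hLtop : L ≠ ∞)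
    {t₀ : ℝ} (ht₀ : t₀ ∈ Ico 0 T) :
    volume {t ∈ Ioo t₀ T | L ≤ ∫⁻ x, ENNReal.ofReal (frobeniusNormSq (fderiv ℝ (u t) x))} ≤
      ENNReal.ofReal (VectorCalculus.kineticEnergy (u 0)) / (ENNReal.ofReal ν * L) := by
  refine (measure_mono fun t ht => ?_).trans (volume_level_le_energy_div hns hlh hT hν hL0 hLtop)
  exact ⟨⟨ht₀.1.trans_lt ht.1.1, ht.1.2⟩, ht.2⟩

end Summit.NavierStokesRegularity.FluidComputer.EnstrophyResidenceCeiling
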